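import Literature.Computability.Complexity.OracleComputations
import HarnessLib

/-!
# Replaying an oracle computation against a transcript: laws of the step function `toStep`

Trunk `CplxCore`, companion of `OracleComputations.lean`. There an oracle computation
`c : OracleComp β` (a query/answer tree) is turned into G01's step function by
`OracleComp.toStep c answers` — follow the answers received so far down the tree and report the
next query or the output — and `run_toOracleAlg` relates the fuelled runner to `eval`. What is
missing for proving that a *concrete* step function is polynomial-time (the programming facts
`Shor1997.shorComp_isPolyTime`, `bmOracleAlg_isPolyTime`, …) is the algebra of `toStep` on an
**arbitrary** transcript (the step function must be computed on every answer list, not only on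
the oracle's): a machine computing `toStep (c x) answers` replays `c x` from the start,
consuming one recorded answer per query, and stops at the first query without a recorded
answer. This file provides that replay semantics:

* `OracleComp.head c` — what a computation reports before any answer (its root);
* `OracleComp.resume c answers` — follow the answers as far as they lead: the sub-computation
  reached and the unused answers (`resume_snd_eq_nil`: if the sub-computation still asks, the
  answers are exhausted);
* `toStep_eq_head_resume : toStep c as = head (resume c as).1`;
* `OracleComp.replay c answers` — the replay *outcome*: the pending query, or the result
  with the leftover answers (`replay_bind` is the bind law of this exception/state monad;
  `toStep_eq_replay`, `replay_forEach_ask`);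
* the laws of `resume`/`toStep` for `pure`, `query`, `ask`, **`bind`** (`resume_bind`,
  `toStep_bind`: replay `c`; if it finishes with `b` and leftover answers `as'`, continue with
  `toStep (f b) as'`, otherwise report its pending query), and for a **block of queries**
  `forEach (fun i => ask (g i)) l` (`resume_forEach_ask_of_le`: with at least `|l|` answers the
  block returns the first `|l|` answers and leaves the rest; `toStep_forEach_ask_bind_of_lt`:
  with fewer, the pending query is `g l[|as|]`).

## References

* S. Arora, B. Barak, *Computational Complexity: A Modern Approach*, CUP 2009, §3.4, Def. 3.4
  (oracle Turing machines: the configuration after `i` answers is determined by the input and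
  those answers).
* T. Baker, J. Gill, R. Solovay, *Relativizations of the P =? NP question*, SIAM J. Comput. 4
  (1975), §1 (query machines).
-/

namespace Literature.Computability.Complexity

namespace OracleComp

variable {α β γ : Type}

/-- The root of a computation as a step: a leaf reports its output, an inner node its query.
[Arora–Barak 2009, §3.4] [folklore] -/
def head : OracleComp β → List Bool ⊕ β
  | pure b => Sum.inr b
  | query q _ => Sum.inl q

/-- **Replay against a transcript**: follow the recorded answers down the tree as far as they
lead; return the sub-computation reached together with the unused answers.
[Arora–Barak 2009, §3.4, Def. 3.4] [folklore] -/
def resume : OracleComp β → List (List Bool) → OracleComp β × List (List Bool)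
  | pure b, as => (pure b, as)
  | query q k, [] => (query q k, [])
  | query _ k, a :: as => resume (k a) as

/-- A leaf reports its output. [folklore] -/
@[simp] theorem head_pure (b : β) : head (pure b) = Sum.inr b := rfl

/-- An inner node reports its query. [folklore] -/
@[simp] theorem head_query (q : List Bool) (k : List Bool → OracleComp β) :
    head (query q k) = Sum.inl q := rfl

/-- `ask q` reports `q`. [folklore] -/
@[simp] theorem head_ask (q : List Bool) : head (ask q) = Sum.inl q := rfl

/-- A leaf consumes no answers. [folklore] -/
@[simp] theorem resume_pure (b : β) (as : List (List Bool)) : resume (pure b) as = (pure b, as) := by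
  cases as <;> rfl

/-- A query without a recorded answer is where the replay stops. [folklore] -/
@[simp] theorem resume_query_nil (q : List Bool) (k : List Bool → OracleComp β) :
    resume (query q k) [] = (query q k, []) := rfl

/-- A query with a recorded answer `a` continues in the branch `k a`. [folklore] -/
@[simp] theorem resume_query_cons (q : List Bool) (k : List Bool → OracleComp β) (a : List Bool)
    (as : List (List Bool)) : resume (query q k) (a :: as) = resume (k a) as := rfl

/-- Against the empty transcript nothing moves. [folklore] -/
@[simp] theorem resume_nil (c : OracleComp β) : resume c [] = (c, []) := by
  cases c <;> rfl

/-- `ask q` with an answer available returns it. [folklore] -/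
@[simp] theorem resume_ask_cons (q a : List Bool) (as : List (List Bool)) :
    resume (ask q) (a :: as) = (pure a, as) := by
  simp [ask]

/-- Without answers the step is the root. [folklore] -/
@[simp] theorem toStep_nil (c : OracleComp β) : toStep c [] = head c := by
  cases c <;> rfl

/-- **The step function is the root of the replayed computation.** [Arora–Barak 2009, §3.4] [folklore] -/
theorem toStep_eq_head_resume : ∀ (c : OracleComp β) (as : List (List Bool)),
    toStep c as = head (resume c as).1
  | pure b, as => by cases as <;> rfl
  | query q k, [] => rfl
  | query _ k, a :: as => toStep_eq_head_resume (k a) as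

/-- If the replay stops at a query, the transcript is exhausted. [folklore] -/
theorem resume_snd_eq_nil : ∀ (c : OracleComp β) (as : List (List Bool)) {q : List Bool}
    {k : List Bool → OracleComp β}, (resume c as).1 = query q k → (resume c as).2 = []
  | pure b, as, q, k, h => by simp at h
  | query q k, [], _, _, _ => rfl
  | query _ k, a :: as, q', k', h => resume_snd_eq_nil (k a) as (by simpa using h)

/-- The unused answers are a suffix of the transcript. [folklore] -/
theorem resume_snd_isSuffix : ∀ (c : OracleComp β) (as : List (List Bool)), (resume c as).2 <:+ as
  | pure b, as => by simp
  | query q k, [] => by simp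
  | query _ k, a :: as => (resume_snd_isSuffix (k a) as).trans (List.suffix_cons a as)

/-- **Replay of a sequential composition**: replay `c`; if it finishes with `b` leaving `as'`,
go on replaying `f b` against `as'`; if it is stuck at a query, so is the composition.
[folklore] -/
theorem resume_bind : ∀ (c : OracleComp β) (f : β → OracleComp γ) (as : List (List Bool)),
    resume (OracleComp.bind c f) as =
      match resume c as with
      | (pure b, as') => resume (f b) as'
      | (query q k, as') => (OracleComp.bind (query q k) f, as')
  | pure b, f, as => by cases as <;> rfl
  | query q k, f, [] => rfl
  | query _ k, f, a :: as => by
    simp only [OracleComp.bind, resume_query_cons]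
    exact resume_bind (k a) f as

/-- **Step function of a sequential composition.** [folklore] -/
theorem toStep_bind (c : OracleComp β) (f : β → OracleComp γ) (as : List (List Bool)) :
    toStep (OracleComp.bind c f) as =
      match resume c as with
      | (pure b, as') => toStep (f b) as'
      | (query q _, _) => Sum.inl q := by
  rw [toStep_eq_head_resume, resume_bind]
  rcases h : resume c as with ⟨c', as'⟩
  cases c' with
  | pure b => simp [toStep_eq_head_resume]
  | query q k => rfl

/-- Composition after a finished replay. [folklore] -/
theorem toStep_bind_of_resume_pure {c : OracleComp β} {as as' : List (List Bool)} {b : β}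
    (h : resume c as = (pure b, as')) (f : β → OracleComp γ) :
    toStep (OracleComp.bind c f) as = toStep (f b) as' := by
  rw [toStep_bind, h]

/-- Composition after a stuck replay. [folklore] -/
theorem toStep_bind_of_resume_query {c : OracleComp β} {as as' : List (List Bool)} {q : List Bool}
    {k : List Bool → OracleComp β} (h : resume c as = (query q k, as')) (f : β → OracleComp γ) :
    toStep (OracleComp.bind c f) as = Sum.inl q := by
  rw [toStep_bind, h]

/-- `pure` then `f` replays as `f`. [folklore] -/
@[simp] theorem toStep_pure_bind (b : β) (f : β → OracleComp γ) (as : List (List Bool)) :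
    toStep (OracleComp.bind (pure b) f) as = toStep (f b) as := rfl

/-- The step function of a leaf is its output, whatever the transcript. [folklore] -/
@[simp] theorem toStep_pure' (b : β) (as : List (List Bool)) : toStep (pure b : OracleComp β) as = Sum.inr b := by
  cases as <;> rfl

/-! ### Blocks of queries -/

/-- **A block of queries with enough answers** returns the first `|l|` answers and leaves the
rest. [folklore] -/
theorem resume_forEach_ask_of_le (g : α → List Bool) : ∀ (l : List α) (as : List (List Bool)),
    l.length ≤ as.length →
    resume (forEach (fun i => ask (g i)) l) as = (pure (as.take l.length), as.drop l.length)
  | [], as, _ => by simp [forEach]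
  | i :: l, [], h => by simp at h
  | i :: l, a :: as, h => by
    have hl : l.length ≤ as.length := by simpa using h
    simp only [forEach, List.length_cons, List.take_succ_cons, List.drop_succ_cons]
    rw [resume_bind, resume_ask_cons]
    dsimp only
    rw [resume_bind, resume_forEach_ask_of_le g l as hl]
    simp

/-- **A block of queries with too few answers** is stuck at query number `|as|`.
[folklore] -/
theorem resume_forEach_ask_of_lt (g : α → List Bool) : ∀ (l : List α) (as : List (List Bool))
    (h : as.length < l.length),
    ∃ k, resume (forEach (fun i => ask (g i)) l) as = (query (g (l[as.length]'h)) k, [])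
  | [], as, h => by simp at h
  | i :: l, [], _ =>
    ⟨fun b => OracleComp.bind (forEach (fun i => ask (g i)) l) fun bs => pure (b :: bs), rfl⟩
  | i :: l, a :: as, h => by
    have hl : as.length < l.length := by simpa using h
    obtain ⟨k, hk⟩ := resume_forEach_ask_of_lt g l as hl
    refine ⟨fun a' => OracleComp.bind (k a') fun bs => pure (a :: bs), ?_⟩
    simp only [forEach, List.length_cons]
    rw [resume_bind, resume_ask_cons]
    dsimp only
    rw [resume_bind, hk]
    simp [OracleComp.bind]

/-- Step function of a block of queries followed by `f`, enough answers. [folklore] -/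
theorem toStep_forEach_ask_bind_of_le (g : α → List Bool) (l : List α) (f : List (List Bool) → OracleComp γ)
    {as : List (List Bool)} (h : l.length ≤ as.length) :
    toStep (OracleComp.bind (forEach (fun i => ask (g i)) l) f) as = toStep (f (as.take l.length)) (as.drop l.length) :=
  toStep_bind_of_resume_pure (resume_forEach_ask_of_le g l as h) f

/-- Step function of a block of queries followed by `f`, too few answers: the pending query.
[folklore] -/
theorem toStep_forEach_ask_bind_of_lt (g : α → List Bool) (l : List α) (f : List (List Bool) → OracleComp γ)
    {as : List (List Bool)} (h : as.length < l.length) :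
    toStep (OracleComp.bind (forEach (fun i => ask (g i)) l) f) as = Sum.inl (g (l[as.length]'h)) := by
  obtain ⟨k, hk⟩ := resume_forEach_ask_of_lt g l as h
  exact toStep_bind_of_resume_query hk f

/-! ### The replay outcome: pending query, or result with leftover answers -/

/-- **Outcome of a replay**: the pending query (`Sum.inl q`), or the result reached together
with the unused answers (`Sum.inr (b, as')`). This is the form in which a machine computing the
step function threads the transcript through a sequential composition (`replay_bind`).
[Arora–Barak 2009, §3.4] [folklore] -/
def replay (c : OracleComp β) (as : List (List Bool)) : List Bool ⊕ (β × List (List Bool)) :=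
  match resume c as with
  | (pure b, as') => Sum.inr (b, as')
  | (query q _, _) => Sum.inl q

/-- The step function is the replay outcome with the leftover answers forgotten. [folklore] -/
theorem toStep_eq_replay (c : OracleComp β) (as : List (List Bool)) :
    toStep c as = (replay c as).map id Prod.fst := by
  rw [toStep_eq_head_resume, replay]
  rcases h : resume c as with ⟨c', as'⟩
  cases c' <;> rfl

/-- Outcome of a leaf: its value, all answers left over. [folklore] -/
@[simp] theorem replay_pure (b : β) (as : List (List Bool)) : replay (pure b) as = Sum.inr (b, as) := by
  simp [replay]

/-- Outcome of an unanswered query: pending. [folklore] -/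
@[simp] theorem replay_query_nil (q : List Bool) (k : List Bool → OracleComp β) :
    replay (query q k) [] = Sum.inl q := rfl

/-- Outcome of an answered query: that of the branch taken. [folklore] -/
@[simp] theorem replay_query_cons (q : List Bool) (k : List Bool → OracleComp β) (a : List Bool)
    (as : List (List Bool)) : replay (query q k) (a :: as) = replay (k a) as := rfl

/-- Outcome of `ask q` without answers: `q` is pending. [folklore] -/
@[simp] theorem replay_ask_nil (q : List Bool) : replay (ask q) [] = Sum.inl q := rfl

/-- Outcome of `ask q` with an answer: the answer, the rest left over. [folklore] -/
@[simp] theorem replay_ask_cons (q a : List Bool) (as : List (List Bool)) :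
    replay (ask q) (a :: as) = Sum.inr (a, as) := by
  simp [replay]

/-- **Replay of a sequential composition** (the bind law of the replay outcome). [folklore] -/
theorem replay_bind (c : OracleComp β) (f : β → OracleComp γ) (as : List (List Bool)) :
    replay (OracleComp.bind c f) as =
      match replay c as with
      | Sum.inr (b, as') => replay (f b) as'
      | Sum.inl q => Sum.inl q := by
  simp only [replay, resume_bind]
  rcases h : resume c as with ⟨c', as'⟩
  cases c' with
  | pure b => rfl
  | query q k => rfl

/-- Composition after a finished replay. [folklore] -/
theorem replay_bind_of_inr {c : OracleComp β} {as as' : List (List Bool)} {b : β}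
    (h : replay c as = Sum.inr (b, as')) (f : β → OracleComp γ) :
    replay (OracleComp.bind c f) as = replay (f b) as' := by
  rw [replay_bind, h]

/-- Composition after a stuck replay. [folklore] -/
theorem replay_bind_of_inl {c : OracleComp β} {as : List (List Bool)} {q : List Bool}
    (h : replay c as = Sum.inl q) (f : β → OracleComp γ) :
    replay (OracleComp.bind c f) as = Sum.inl q := by
  rw [replay_bind, h]

/-- The step function from the replay outcome, finished case. [folklore] -/
theorem toStep_of_replay_inr {c : OracleComp β} {as as' : List (List Bool)} {b : β}
    (h : replay c as = Sum.inr (b, as')) : toStep c as = Sum.inr b := by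
  rw [toStep_eq_replay, h]; rfl

/-- The step function from the replay outcome, stuck case. [folklore] -/
theorem toStep_of_replay_inl {c : OracleComp β} {as : List (List Bool)} {q : List Bool}
    (h : replay c as = Sum.inl q) : toStep c as = Sum.inl q := by
  rw [toStep_eq_replay, h]; rfl

/-- **Replay of a block of queries**: with at least `|l|` answers it returns the first `|l|`
and leaves the rest; with fewer it is stuck at query number `|as|`. [folklore] -/
theorem replay_forEach_ask (g : α → List Bool) (l : List α) (as : List (List Bool)) :
    replay (forEach (fun i => ask (g i)) l) as =
      if h : l.length ≤ as.length then Sum.inr (as.take l.length, as.drop l.length)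
      else Sum.inl (g (l[as.length]'(not_le.1 h))) := by
  split_ifs with h
  · simp [replay, resume_forEach_ask_of_le g l as h]
  · obtain ⟨k, hk⟩ := resume_forEach_ask_of_lt g l as (not_le.1 h)
    simp [replay, hk]

/-- The leftover answers of a finished replay are a suffix of the transcript. [folklore] -/
theorem isSuffix_of_replay_inr {c : OracleComp β} {as as' : List (List Bool)} {b : β}
    (h : replay c as = Sum.inr (b, as')) : as' <:+ as := by
  simp only [replay] at h
  rcases h' : resume c as with ⟨c', as''⟩
  rw [h'] at h
  cases c' with
  | pure b' =>
    simp only [Sum.inr.injEq, Prod.mk.injEq] at h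
    rw [← h.2, show as'' = (resume c as).2 by rw [h']]
    exact resume_snd_isSuffix c as
  | query q k => simp at h

/-! ### Consistency with `eval` -/

/-- Replaying against (a prefix of) the oracle's own answers and then evaluating gives the
evaluation: `eval O (resume c as).1 = eval O c` whenever `as` is a prefix of `queryList`'s
answers — stated in the form used by step-function machines: the answers are `O` applied to
the queries asked. [folklore] -/
theorem eval_resume_fst (O : Oracle) : ∀ (c : OracleComp β) (as : List (List Bool)),
    as <+: (queryList O c).map O → eval O (resume c as).1 = eval O c
  | pure b, as, _ => by simp
  | query q k, [], _ => rfl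
  | query q k, a :: as, h => by
    simp only [queryList, List.map_cons, List.cons_prefix_cons] at h
    obtain ⟨rfl, h⟩ := h
    simp only [resume_query_cons, eval_query]
    exact eval_resume_fst O (k (O q)) as h

end OracleComp

end Literature.Computability.Complexity
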